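import Mathlib
import Literature.MathematicalPhysics.QuantumFieldTheory.Balaban1983to89.B12Decay510Torus

/-!
# T⁴ programme, node NE3 (η-rate of the minimisers) — the slice-operator TORUS MODEL, file 1/4:
# blocks of the periodic lattice `(ℤ/T)^d` (one coordinate, points, the integer periodic ℓ¹ length, ball counts)

Tenth generation of the NE3 prover lineage P1 of the cell `pub-balaban` (technique: implicit-function / fixed-point
structure of the one-step constrained variational problem, Bałaban CMP 102 (1985) = "B11", Sect. E, read as the DISCRETE
implicit-function theorem = STABILITY × CONSISTENCY).  THE SERIES (`SliceTorusBlocks` → `SliceTorusBlockModel` →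
`SliceTorusTower` → `SliceTorusSkeleton`) DISCHARGES, on Bałaban's own carrier (the periodic lattice with its nested block
structure), the NINE GEOMETRY BINDERS (`hρ0`, `hρsymm`, `htri`, `hlen`, `hbd`, `hρbd`, `hcount`, `hnest`, `hdiam`) and the
THREE DICTIONARY BINDERS (`hobsA`, `hobsB` : `RowObservedBy`, `hdom` : `EntryDominated`) of the ninth-generation theorem
`T4SliceOperatorData.sliceKernel_bound_of_printedType` (per-level slice bounds of the NE3 chain from the printed TYPE of
B9 (3.42)/(3.49)) — eleven as theorems outright and `hbd` relative to a free dominating site distance — and then states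
the NE3 skeleton end to end with the printed family statements `B9.Thm31Printed` / `B9.Stmt349Printed` BY NAME (file 4).

THIS FILE [model geometry, proved; integer arithmetic on `ℤ/T`]: §1 the block index `blockOf e : ℤ/T → ℤ/M` (`T = M·e`,
`⌊val a / e⌋ mod M`) with the per-coordinate dictionary `pabs_sub_le_blockOf` — **`|a − b|_T ≤ e·|βa − βb|_M + (e − 1)`**
(lifting the minimal representative of the block difference), `pabs_sub_le_of_blockOf_eq` (same block ⇒ `|a − b|_T ≤ e − 1`),
`blockOf_nest` (`e ∣ e′` ⇒ coarser blocks are unions of finer ones); §2 points of `(ℤ/T)^d`: `blockPt`, the integer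
periodic ℓ¹ length `npl1` (`cast_npl1 : npl1 = pl1`, `eq_of_npl1_sub_eq_zero`, `npl1_sub_tri4`), `pl1_sub_le_blockPt`,
`pl1_sub_le_of_blockPt_eq`, `blockPt_nest`, and `card_sphere_le` — **at most `2^d(r+1)^d` points of `(ℤ/M)^d` at integer
periodic ℓ¹ distance exactly `r` from a point**, uniformly in `M` (injection into the box `[−r, r]^d` of minimal
representatives, `vmaVec_injective`).  The bounds of §1 are attained (examples in `SliceTorusTower`).

## What is printed and located ([R] = certified wordings; NOTHING of it enters as a hypothesis anywhere in the series)

* [R] B9 = Bałaban, *Propagators for lattice gauge theories in a background field*, CMP 99 (1985) 389–434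
  (`paper:balaban1985-cmp99-background-propagators`), p. 397 [p0009.txt:L25–L28 of the materialised text, OCR-garbled
  there; certified wording as typed in the docstring of `B9.Geometry` by the literature seat]: «we will use the weighted
  distance d(y, y′) defined by (2.36) in [4], and the families of cubes Δ(y), Δ̃(y). Here y, y′ ∈ 𝔅 = ⋃_{j=0}^k Λ_j. Let
  us recall that if y ∈ Λ_j, then Δ(y) = B^j(y), and Δ̃(y) is a cube of the size 2L^jη on the lattice T_η with center at
  the point y» — the DICTIONARY of the series: `Λ_j` ↦ the level-`j` block index torus `(ℤ/N·L^{n−j})^d`, `x ∈ Δ(y) =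
  B^j(y)` ↦ `cube j x = y`, `L^jη` ↦ `L^j` (lattice units, `η = 1`); B9's `d(y,y′)` is NOT constructed — the model's block
  distance is the integer periodic ℓ¹ distance of block indices and the domination `d ≥ nbd` needed for the real objects
  is part of reading (I′) (records), carried as the hypothesis `hbd` of files 3–4.
* [R] B12 = Bałaban, *Renormalization group approach to lattice gauge field theories. I*, CMP 109 (1987) 249–301, p. 251
  [certified wording of the header of `B12Decay510Torus`]: «a torus T obtained by the usual identification of boundary
  points of the cube {x ∈ R^d : −L_μ ≦ x_μ ≦ L_μ, μ = 1, …, d}» — the periodic carrier; the fine lattice of the series is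
  the torus `(ℤ/NLⁿ)^d` of `TreeLengthTorus.TPt` with the periodic ℓ¹ distance `B12Decay510Torus.pl1` (= `|x − y|` of B12
  (5.10), the distance `ρ` of `T4SliceTelescoping`).
* The printed wordings of B9 Theorem 3.1 / Theorem 3.3 / (3.49) / (3.35) used by the series are reproduced byte-for-byte
  in the header of `T4SliceOperatorData` v1.1 (ll. 96–118; XREADs C-t4r3-50, C-ref5-206), imported by files 2–4;
  they are not repeated here.

Honest framing (all four files): finite-T⁴ ultraviolet bookkeeping about MINIMISERS (rung (B)+1 of the cell's ladder); no
conditional of the cell (`BetaPertH`, (B), (B^μ)) is used or hidden; nothing bears on infinite volume, a mass gap, or the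
Clay problem; NE3 is NOT proved — the value is a typed skeleton with the gap located (the hypotheses of
`SliceTorusSkeleton.ne3Shape_torus_of_printedStatements`).  ABSOLUTE RULE of the cell kept: no internally-minted statement
enters as a cited fact; B9's theorems enter only as HYPOTHESES of the tree's typed, cite-tagged shapes; the manuscripts
under audit are not cited for any disputed step.  No `sorry`, no axioms beyond Mathlib's; integer/real arithmetic, finite
sums and sups are [folklore]; every [model] sentence is dictionary, never a hypothesis discharged by citation.  PLACEMENT
(human rule 2026-08-19): new cell work lives under `Summits/QuantumFields/BalabanUV/`; this series imports the lineage's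
earlier leaves where they landed (`Literature.….Balaban1983to89.T4SliceOperatorData` v1.1 p193857, `B12Decay510Torus`)
and moves nothing.  Records: `t4/T4-EST-U1b-OSC.md` v1.22 (RESULTS 28, 29), `t4/T4-EST-NE3-P1.md` v2.20, GAPS
G-ne3p1-35/36 of the cell `pub-balaban` (HOME `run/shared/lean/pub/pub-balaban/`).
-/

noncomputable section

open Finset Real

namespace Summit.QuantumFields.BalabanUV.T4Continuum.SliceTorusBlocks

open Literature.MathematicalPhysics.QuantumFieldTheory.Balaban1983to89
open Literature.MathematicalPhysics.QuantumFieldTheory.Balaban1983to89.TreeLengthTorus (TPt)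
open Literature.MathematicalPhysics.QuantumFieldTheory.Balaban1983to89.B12Decay510Torus
  (pabs pabs_eq_natAbs pabs_nonneg pabs_zero exists_eq_add_mul_of_cast_eq pabs_le_abs_of_cast_eq
    vmaVec vmaVec_injective pl1 pl1_eq_sum pl1_nonneg pl1_sub_comm pl1_sub_triangle)

/-! ## §1  One coordinate: the block index `⌊val a / e⌋ mod M` on `ℤ/T`, `T = M·e` -/
section OneCoordinate

variable {T M e : ℕ}

/-- The BLOCK INDEX of a residue `a ∈ ℤ/T` for blocks of `e` consecutive residues, `T = M·e`: the class of
`⌊val a / e⌋` in `ℤ/M` (blocks `{0,…,e−1}, {e,…,2e−1}, …` of the cycle; `M` of them). [folklore] -/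
def blockOf (M e : ℕ) (a : ZMod T) : ZMod M := ((a.val / e : ℕ) : ZMod M)

/-- A factor of a nonzero natural number is positive: `T = M·e ≠ 0 ⇒ 0 < e`. [folklore] -/
theorem pos_of_mul_eq [NeZero T] (hT : T = M * e) : 0 < e :=
  Nat.pos_of_ne_zero fun h => NeZero.ne T (by rw [hT, h, mul_zero])

/-- `⌊val a / e⌋ < M`. [folklore] -/
theorem val_div_lt [NeZero T] (hT : T = M * e) (a : ZMod T) : a.val / e < M := by
  have ha : a.val < M * e := lt_of_lt_of_eq (ZMod.val_lt a) hT
  exact (Nat.div_lt_iff_lt_mul (pos_of_mul_eq hT)).2 ha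

/-- `val (blockOf a) = ⌊val a / e⌋`. [folklore] -/
theorem val_blockOf [NeZero T] (hT : T = M * e) (a : ZMod T) : (blockOf M e a).val = a.val / e :=
  ZMod.val_cast_of_lt (val_div_lt hT a)

/-- **The per-coordinate distance dictionary**: the periodic distance of two residues is at most `e` times the
periodic distance of their block indices plus the in-block spread `e − 1`:
`|x − z|_T ≤ e·|β x − β z|_M + (e − 1)`. [folklore] -/
theorem pabs_sub_le_blockOf [NeZero T] (hT : T = M * e) (x z : ZMod T) :
    pabs (x - z) ≤ e * pabs (blockOf M e x - blockOf M e z) + ((e : ℤ) - 1) := by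
  have he : 0 < e := pos_of_mul_eq hT
  set qx := x.val / e with hqx
  set qz := z.val / e with hqz
  set v : ℤ := (blockOf M e x - blockOf M e z).valMinAbs with hv
  have hcast : ((((qx : ℤ) - qz : ℤ)) : ZMod M) = ((v : ℤ) : ZMod M) := by
    rw [hv, ZMod.coe_valMinAbs]
    push_cast
    rfl
  obtain ⟨k, hk⟩ := exists_eq_add_mul_of_cast_eq hcast
  have hxdm : (x.val : ℤ) = e * qx + (x.val % e : ℕ) := by
    have := Nat.div_add_mod x.val e
    push_cast
    rw [hqx]
    exact_mod_cast this.symm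
  have hzdm : (z.val : ℤ) = e * qz + (z.val % e : ℕ) := by
    have := Nat.div_add_mod z.val e
    push_cast
    rw [hqz]
    exact_mod_cast this.symm
  set w : ℤ := (x.val : ℤ) - z.val + k * T with hw
  have hwcast : ((w : ℤ) : ZMod T) = x - z := by
    rw [hw]
    push_cast
    rw [ZMod.natCast_zmod_val, ZMod.natCast_zmod_val, ZMod.natCast_self, mul_zero, add_zero]
  have h1 : pabs (x - z) ≤ |w| := pabs_le_abs_of_cast_eq hwcast
  have hTz : (T : ℤ) = M * e := by exact_mod_cast hT
  have hw' : w = e * v + (((x.val % e : ℕ) : ℤ) - ((z.val % e : ℕ) : ℤ)) := by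
    rw [hw, hk, hxdm, hzdm, hTz]
    ring
  have hr : |((x.val % e : ℕ) : ℤ) - ((z.val % e : ℕ) : ℤ)| ≤ (e : ℤ) - 1 := by
    have h₁ := Nat.mod_lt x.val he
    have h₂ := Nat.mod_lt z.val he
    rw [abs_le]
    constructor <;> omega
  have hpv : pabs (blockOf M e x - blockOf M e z) = |v| := rfl
  calc pabs (x - z) ≤ |w| := h1
    _ = |e * v + (((x.val % e : ℕ) : ℤ) - ((z.val % e : ℕ) : ℤ))| := by rw [hw']
    _ ≤ |(e : ℤ) * v| + |((x.val % e : ℕ) : ℤ) - ((z.val % e : ℕ) : ℤ)| := abs_add_le _ _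
    _ = e * |v| + |((x.val % e : ℕ) : ℤ) - ((z.val % e : ℕ) : ℤ)| := by
        rw [abs_mul, abs_of_nonneg (by positivity : (0 : ℤ) ≤ e)]
    _ ≤ e * pabs (blockOf M e x - blockOf M e z) + ((e : ℤ) - 1) := by rw [hpv]; linarith

/-- Two residues with the same block index are within `e − 1` of each other on the cycle. [folklore] -/
theorem pabs_sub_le_of_blockOf_eq [NeZero T] (hT : T = M * e) {x z : ZMod T}
    (h : blockOf M e x = blockOf M e z) : pabs (x - z) ≤ (e : ℤ) - 1 := by
  have := pabs_sub_le_blockOf hT x z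
  rw [h, sub_self, pabs_zero, mul_zero, zero_add] at this
  exact this

/-- **Nesting**: blocks of side `e′`, `e ∣ e′`, are unions of blocks of side `e` — equal fine block indices imply
equal coarse block indices. [folklore] -/
theorem blockOf_nest [NeZero T] {M' e' : ℕ} (hT : T = M * e) (hee' : e ∣ e') {x z : ZMod T}
    (h : blockOf M e x = blockOf M e z) : blockOf M' e' x = blockOf M' e' z := by
  have hq : x.val / e = z.val / e := by
    have := congrArg ZMod.val h
    rwa [val_blockOf hT, val_blockOf hT] at this
  obtain ⟨f, hf⟩ := hee'
  unfold blockOf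
  rw [hf, ← Nat.div_div_eq_div_mul, ← Nat.div_div_eq_div_mul, hq]

end OneCoordinate

/-! ## §2  Points of the torus `(ℤ/T)^d`: block points, the integer periodic ℓ¹ length, the count of balls -/
section Sites

variable {d T M e : ℕ}

/-- The INTEGER periodic ℓ¹ length `Σ_i |w_i|_T ∈ ℕ` (the integer-valued copy of `B12Decay510Torus.pl1`). [folklore] -/
def npl1 (w : TPt d T) : ℕ := ∑ i, (w i).valMinAbs.natAbs

/-- `npl1 = pl1` as real numbers. [folklore] -/
theorem cast_npl1 (w : TPt d T) : (npl1 w : ℝ) = pl1 w := by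
  rw [pl1_eq_sum, npl1]
  push_cast
  refine Finset.sum_congr rfl fun i _ => ?_
  rw [Nat.cast_natAbs, Int.cast_abs, pabs, Int.cast_abs]

/-- Zero integer periodic ℓ¹ distance means equality (the binder `hzero` of the consistency geometry). [folklore] -/
theorem eq_of_npl1_sub_eq_zero {x y : TPt d T} (h : npl1 (x - y) = 0) : y = x := by
  unfold npl1 at h
  rw [Finset.sum_eq_zero_iff] at h
  funext i
  have hi := h i (Finset.mem_univ i)
  rw [Int.natAbs_eq_zero, ZMod.valMinAbs_eq_zero, Pi.sub_apply, sub_eq_zero] at hi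
  exact hi.symm

/-- The 3-point (two intermediate points) triangle inequality of the integer periodic ℓ¹ distance (binder `htri`
of the consistency geometry). [folklore] -/
theorem npl1_sub_tri4 [NeZero T] (x z w y : TPt d T) :
    npl1 (x - y) ≤ npl1 (x - z) + npl1 (z - w) + npl1 (w - y) := by
  have h : (npl1 (x - y) : ℝ) ≤ npl1 (x - z) + npl1 (z - w) + npl1 (w - y) := by
    rw [cast_npl1, cast_npl1, cast_npl1, cast_npl1]
    calc pl1 (x - y) ≤ pl1 (x - w) + pl1 (w - y) := pl1_sub_triangle x w y
      _ ≤ pl1 (x - z) + pl1 (z - w) + pl1 (w - y) := add_le_add (pl1_sub_triangle x z w) le_rfl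
  exact_mod_cast h

/-- The BLOCK POINT of `x ∈ (ℤ/T)^d`: coordinatewise block indices, a point of `(ℤ/M)^d`. [folklore] -/
def blockPt (M e : ℕ) (x : TPt d T) : TPt d M := fun i => blockOf M e (x i)

/-- **Distance dictionary** `ρ ≤ e·(block distance) + d(e − 1)`:
`|x − z| ≤ e·|β x − β z| + d·(e − 1)` for the periodic ℓ¹ lengths. [folklore] -/
theorem pl1_sub_le_blockPt [NeZero T] (hT : T = M * e) (x z : TPt d T) :
    pl1 (x - z) ≤ e * pl1 (blockPt M e x - blockPt M e z) + d * ((e : ℝ) - 1) := by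
  rw [pl1_eq_sum, pl1_eq_sum, Finset.mul_sum]
  have h : ∀ i, (pabs ((x - z) i) : ℝ) ≤ e * (pabs ((blockPt M e x - blockPt M e z) i) : ℝ) + ((e : ℝ) - 1) := by
    intro i
    have := pabs_sub_le_blockOf hT (x i) (z i)
    have h' : ((pabs (x i - z i) : ℤ) : ℝ) ≤ ((e * pabs (blockOf M e (x i) - blockOf M e (z i)) + ((e : ℤ) - 1) : ℤ) : ℝ) := by
      exact_mod_cast this
    push_cast at h'
    simpa [blockPt] using h'
  calc ∑ i, (pabs ((x - z) i) : ℝ) ≤ ∑ i : Fin d, (e * (pabs ((blockPt M e x - blockPt M e z) i) : ℝ) + ((e : ℝ) - 1)) :=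
        Finset.sum_le_sum fun i _ => h i
    _ = _ := by rw [Finset.sum_add_distrib, Finset.sum_const, Finset.card_univ, Fintype.card_fin]; simp

/-- Same block point ⇒ `|x − z| ≤ d(e − 1)`. [folklore] -/
theorem pl1_sub_le_of_blockPt_eq [NeZero T] (hT : T = M * e) {x z : TPt d T}
    (h : blockPt M e x = blockPt M e z) : pl1 (x - z) ≤ d * ((e : ℝ) - 1) := by
  rw [pl1_eq_sum]
  have hi : ∀ i, (pabs ((x - z) i) : ℝ) ≤ (e : ℝ) - 1 := by
    intro i
    have hc : blockOf M e (x i) = blockOf M e (z i) := congrFun h i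
    have := pabs_sub_le_of_blockOf_eq hT hc
    have h' : ((pabs (x i - z i) : ℤ) : ℝ) ≤ (((e : ℤ) - 1 : ℤ) : ℝ) := by exact_mod_cast this
    push_cast at h'
    simpa using h'
  calc ∑ i, (pabs ((x - z) i) : ℝ) ≤ ∑ _i : Fin d, ((e : ℝ) - 1) := Finset.sum_le_sum fun i _ => hi i
    _ = d * ((e : ℝ) - 1) := by rw [Finset.sum_const, Finset.card_univ, Fintype.card_fin]; simp

/-- Nesting of block points. [folklore] -/
theorem blockPt_nest [NeZero T] {M' e' : ℕ} (hT : T = M * e) (hee' : e ∣ e') {x z : TPt d T}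
    (h : blockPt M e x = blockPt M e z) : blockPt M' e' x = blockPt M' e' z :=
  funext fun i => blockOf_nest hT hee' (congrFun h i)

/-- **The count of spheres (by balls)**: on `(ℤ/M)^d`, at most `(2r+1)^d ≤ 2^d(r+1)^d` points lie at integer periodic
ℓ¹ distance exactly `r` from a given point — uniformly in `M`. [folklore] -/
theorem card_sphere_le [NeZero M] (b₀ : TPt d M) (r : ℕ) :
    ((Finset.univ.filter fun b : TPt d M => npl1 (b₀ - b) = r).card : ℝ) ≤ (2 : ℝ) ^ d * ((r : ℝ) + 1) ^ d := by
  classical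
  set S := Finset.univ.filter fun b : TPt d M => npl1 (b₀ - b) = r with hS
  set B : Finset (Fin d → ℤ) := Fintype.piFinset fun _ => Finset.Icc (-(r : ℤ)) r with hB
  have hmaps : Set.MapsTo (fun b : TPt d M => vmaVec (b₀ - b)) ↑S ↑B := by
    intro b hb
    have hb' : npl1 (b₀ - b) = r := (Finset.mem_filter.1 hb).2
    rw [Finset.mem_coe, hB, Fintype.mem_piFinset]
    intro i
    have hi : ((b₀ - b) i).valMinAbs.natAbs ≤ r := by
      rw [← hb', npl1]
      exact Finset.single_le_sum (f := fun i => ((b₀ - b) i).valMinAbs.natAbs) (fun _ _ => Nat.zero_le _)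
        (Finset.mem_univ i)
    rw [Finset.mem_Icc]
    simp only [vmaVec]
    constructor <;> omega
  have hinj : Set.InjOn (fun b : TPt d M => vmaVec (b₀ - b)) ↑S := by
    intro b _ b' _ hbb'
    have := vmaVec_injective hbb'
    exact sub_right_injective this
  have hcard : S.card ≤ B.card := Finset.card_le_card_of_injOn _ hmaps hinj
  have hB' : B.card = (2 * r + 1) ^ d := by
    rw [hB, Fintype.card_piFinset, Finset.prod_const, Finset.card_univ, Fintype.card_fin, Int.card_Icc]
    have : (r : ℤ) + 1 - -(r : ℤ) = ((2 * r + 1 : ℕ) : ℤ) := by push_cast; ring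
    rw [this, Int.toNat_natCast]
  have h1 : (S.card : ℝ) ≤ ((2 * r + 1 : ℕ) : ℝ) ^ d := by exact_mod_cast hB' ▸ hcard
  calc (S.card : ℝ) ≤ ((2 * r + 1 : ℕ) : ℝ) ^ d := h1
    _ ≤ (2 * ((r : ℝ) + 1)) ^ d := by
        apply pow_le_pow_left₀ (by positivity)
        push_cast
        linarith
    _ = (2 : ℝ) ^ d * ((r : ℝ) + 1) ^ d := mul_pow _ _ _

end Sites

end Summit.QuantumFields.BalabanUV.T4Continuum.SliceTorusBlocks
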